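import Mathlib
import HarnessLib
import Summits.AtomisticToContinuum.HydrodynamicLimit.Theses.OneFlightGossipEngine
import Summits.AtomisticToContinuum.HydrodynamicLimit.Theses.TwoClocks
import Summits.AtomisticToContinuum.HydrodynamicLimit.Theorems.OneFlightGossipEngineClampedTransferDockChildThreeRung
import Summits.AtomisticToContinuum.HydrodynamicLimit.Theorems.OneFlightGossipEngineLocalClampedTransferLDAlongFamiliesSAxisNet

/-!
# `LCT♯` is crux-sized: it implies TwoClocks' crux C′ — line `Sketch`, crux `LocalClampedTransferLDAlongFamilies`
# (stmt-AtomisticToContinuum-17691)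

Route `OneFlightGossipEngine`, sub-problem `HydrodynamicLimit`. The kernel certificate that the single node `LCTSharp`
left open by the s-axis of line `Sketch` contains an existing crux: `LCTSharp` implies the crux
`LocalClampedTransferLDAlongFamilies` (`stub_sAxisNet`, landed), which is byte-identical with the heart's
`HydroLimitInBandOfHeart.LocalClampedTransferWindowLDFamily`, whose constant-family rung is TwoClocks' crux C′
`ClampedTransferWindowLD` (stmt-AtomisticToContinuum-16623; `ClampedTransferDockBridge.clampedTransferWindowLD_of_family`,
landed). Hence no line of this crux ending at `LCTSharp` can be cheaper than 16623's open core.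
-/

noncomputable section

namespace Summit.AtomisticToContinuum.HydrodynamicLimit.Theorems.LocalClampedTransferSketch

open Summit.AtomisticToContinuum.HydrodynamicLimit.Theses

/-- **`LCT♯ ⟹` TwoClocks' crux C′ `ClampedTransferWindowLD`** (stmt-AtomisticToContinuum-16623): the profile-wise node with
numeric clamp/tilt thresholds is crux-sized (through the family crux 17691 and its landed constant-family rung). -/
theorem stub_lctSharpImpliesRung : LCTSharp → TwoClocks.ClampedTransferWindowLD := fun h =>
  ClampedTransferDockBridge.clampedTransferWindowLD_of_family (stub_sAxisNet h)

/-- The crux itself implies TwoClocks' C′ (restated here by name for the line's record: the family crux is at least as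
strong as its constant-family rung). -/
theorem localClampedTransferLDAlongFamilies_implies_rung :
    OneFlightGossipEngine.LocalClampedTransferLDAlongFamilies → TwoClocks.ClampedTransferWindowLD := fun h =>
  ClampedTransferDockBridge.clampedTransferWindowLD_of_family h

end Summit.AtomisticToContinuum.HydrodynamicLimit.Theorems.LocalClampedTransferSketch

end
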